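import Mathlib
import Summits.ValiantsHypothesis.ValiantsHypothesis.Theorems.TwoProducts.Negative.RealizableDissociationSizeMismatch
import HarnessLib

/-!
# Two exchange relations in independent directions lie outside the R12 and R13♯ hatches — for EVERY presentation

Negative lane, `--supports stmt-ValiantsHypothesis-5906` (route `NewtonUnitEquations`, crux `TwoProducts`, line `relation_ladder` v24/v25).
No summit statement is proved here; VP ≠ VNP is NOT proved.  Sequel to ✓ `Negative/RealizableDissociationSizeMismatch.lean` (same seat, p697842),
which excludes SIZE-MISMATCHED coincidences from the hatches; this file treats the SAME-SIZE content the v25 docstring names as residual: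
«alphabets needing ≥ 2 independent shift directions».

KEY LEMMA `sub_parallel_of_exchange` (in words): under a realizable-dissociated one-direction tower presentation `(x, d, E)`
(`TowerRecord.TowerDissociatedE x d m E`, `2 ≤ m`) a presented coincidence `α + δ = β + γ` is a FIBRE EXCHANGE — the two pairs
`(δ_{i(α)} + δ_{i(δ)}, j(α)+j(δ))`, `(δ_{i(β)} + δ_{i(γ)}, j(β)+j(γ))` have the same planar point, dissociation equates the carrier multisets, so
`i(α) ∈ {i(β), i(γ)}` and `α − β ∈ ℤ•d ∨ α − γ ∈ ℤ•d`: ONE exchange relation pins `d` to one of two lattice directions.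
THEOREMS: eight tail letters with `α₁+δ₁ = β₁+γ₁`, `α₂+δ₂ = β₂+γ₂` whose candidate directions are pairwise NON-PARALLEL across the two relations —
the four integer 2×2 determinants `det(α₁−β₁ | α₂−β₂)`, `det(α₁−β₁ | α₂−γ₂)`, `det(α₁−γ₁ | α₂−β₂)`, `det(α₁−γ₁ | α₂−γ₂)` are `≠ 0` (this also
excludes the permutation coincidences `α_s = β_s` / `α_s = γ_s` and covers `d = 0`) — admit NO such presentation: literal forms
`towerAlphabet_not_dissociatedE_of_twoDirections : ∀ n x d E, TowerAlphabet u v x d E → ¬ TowerDissociatedE x d m E` and the `shiftZ`/`CarrierDissociated`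
twin `shiftedAlphabet_not_carrierDissociated_of_twoDirections`, and the v25 / v24 hatch existentials of `ResidualLawV25` negated verbatim
(`towerHatch_false_of_twoDirections`, `shiftedHatch_false_of_twoDirections`).  FIRST INSTANCE: two exchange quadruples `{p, p+d₁, p′, p′+d₁}`,
`{q, q+d₂, q′, q′+d₂}` among the tail letters (`α₁ = p, β₁ = p+d₁, γ₁ = p′, δ₁ = p′+d₁`, likewise for `q`) with each of `d₁, p−p′` non-parallel to
each of `d₂, q−q′`, `m ≥ 2`.
HONEST LABEL (as for the size-mismatch file): a presentation-free membership CRITERION for the complement of the v24/v25 hatches, complementary to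
size mismatch (same-size relations) — bookkeeping on the Negative lane, NOT a refutation, NOT «the hatch is empty» (one-direction exchange families
and carry-free towers remain in it), 0 distance on `ResidualLawV25` / `PlanarCellBound` / `stub_residual`. [folklore]
-/

set_option linter.dupNamespace false

open scoped BigOperators
open Summit.ValiantsHypothesis.ValiantsHypothesis.Theorems.NewtonUnitEquations.TwoProducts.FormalLogLinearisation
open Summit.ValiantsHypothesis.ValiantsHypothesis.Theorems.NewtonUnitEquations.TwoProducts.PlanarCell
open Summit.ValiantsHypothesis.ValiantsHypothesis.Theorems.NewtonUnitEquations.TwoProducts.MomentRecord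
open Summit.ValiantsHypothesis.ValiantsHypothesis.Theorems.NewtonUnitEquations.TwoProducts.TowerRecord
open Summit.ValiantsHypothesis.ValiantsHypothesis.Theorems.NewtonUnitEquations.TwoProducts.TowerRecord.Lift
open Summit.ValiantsHypothesis.ValiantsHypothesis.Theorems.NewtonUnitEquations.TwoProducts.Negative.SizeMismatch (ptZ_add_single)

namespace Summit.ValiantsHypothesis.ValiantsHypothesis.Theorems.NewtonUnitEquations.TwoProducts.Negative.TwoDirections

variable {m n : ℕ}

/-- The pair `(δ_i + δ_i', j + j')` realised by two presented letters: size `2`, level sum in `2·E`, planar point the sum. [folklore] -/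
theorem pair_realizable (x : Fin n → Expo) (d : Fin 2 → ℤ) (E : Finset ℕ) {α δ : Expo} {i i' : Fin n} {j j' : ℕ}
    (hj : j ∈ E) (hj' : j' ∈ E)
    (hα : ∀ c, ((α c : ℕ) : ℤ) = ((x i c : ℕ) : ℤ) + (j : ℤ) * d c) (hδ : ∀ c, ((δ c : ℕ) : ℤ) = ((x i' c : ℕ) : ℤ) + (j' : ℤ) * d c) :
    size ((0 : Fin n → ℕ) + Pi.single i 1 + Pi.single i' 1) = 2 ∧
      0 + j + j' ∈ sumset E (size ((0 : Fin n → ℕ) + Pi.single i 1 + Pi.single i' 1)) ∧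
      ∀ c, ptZ x d ((0 : Fin n → ℕ) + Pi.single i 1 + Pi.single i' 1) (0 + j + j') c = ((α c : ℕ) : ℤ) + ((δ c : ℕ) : ℤ) := by
  have h0 : size (0 : Fin n → ℕ) = 0 := by simp [size]
  have hs : size ((0 : Fin n → ℕ) + Pi.single i 1 + Pi.single i' 1) = 2 := by rw [size_add_single, size_add_single, h0]
  refine ⟨hs, ?_, fun c => ?_⟩
  · rw [hs]
    show 0 + j + j' ∈ sumset E (1 + 1)
    exact add_mem_sumset_succ (add_mem_sumset_succ (zero_mem_sumset_zero E) hj) hj'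
  · rw [ptZ_add_single, ptZ_add_single, hα, hδ]
    simp [ptZ]

/-- **ONE EXCHANGE RELATION PINS THE DIRECTION**: under a realizable-dissociated tower presentation (`2 ≤ m`), a coincidence
`α + δ = β + γ` of presented letters forces `α − β ∈ ℤ•d` or `α − γ ∈ ℤ•d`. [folklore] -/
theorem sub_parallel_of_exchange (hm : 2 ≤ m) (x : Fin n → Expo) (d : Fin 2 → ℤ) (E : Finset ℕ) {α β γ δ : Expo}
    (hα : ∃ i : Fin n, ∃ j ∈ E, ∀ c, ((α c : ℕ) : ℤ) = ((x i c : ℕ) : ℤ) + (j : ℤ) * d c)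
    (hβ : ∃ i : Fin n, ∃ j ∈ E, ∀ c, ((β c : ℕ) : ℤ) = ((x i c : ℕ) : ℤ) + (j : ℤ) * d c)
    (hγ : ∃ i : Fin n, ∃ j ∈ E, ∀ c, ((γ c : ℕ) : ℤ) = ((x i c : ℕ) : ℤ) + (j : ℤ) * d c)
    (hδ : ∃ i : Fin n, ∃ j ∈ E, ∀ c, ((δ c : ℕ) : ℤ) = ((x i c : ℕ) : ℤ) + (j : ℤ) * d c)
    (hrel : α + δ = β + γ) (hdis : TowerDissociatedE x d m E) :
    (∃ t : ℤ, ∀ c, ((α c : ℕ) : ℤ) - ((β c : ℕ) : ℤ) = t * d c) ∨ (∃ t : ℤ, ∀ c, ((α c : ℕ) : ℤ) - ((γ c : ℕ) : ℤ) = t * d c) := by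
  classical
  obtain ⟨iα, jα, hjα, hα⟩ := hα
  obtain ⟨iβ, jβ, hjβ, hβ⟩ := hβ
  obtain ⟨iγ, jγ, hjγ, hγ⟩ := hγ
  obtain ⟨iδ, jδ, hjδ, hδ⟩ := hδ
  obtain ⟨hs, hk, hpt⟩ := pair_realizable x d E hjα hjδ hα hδ
  obtain ⟨hs', hk', hpt'⟩ := pair_realizable x d E hjβ hjγ hβ hγ
  have heq : ptZ x d ((0 : Fin n → ℕ) + Pi.single iα 1 + Pi.single iδ 1) (0 + jα + jδ) =
      ptZ x d ((0 : Fin n → ℕ) + Pi.single iβ 1 + Pi.single iγ 1) (0 + jβ + jγ) := by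
    funext c
    rw [hpt c, hpt' c]
    have h := congrArg (fun e : Expo => ((e c : ℕ) : ℤ)) hrel
    simpa using h
  have hS := (hdis _ _ _ _ (by rw [hs]; exact hm) (by rw [hs']; exact hm) hk hk' heq).1
  have hαS := congrFun hS iα
  simp only [Pi.add_apply, Pi.zero_apply, Pi.single_apply] at hαS
  by_cases h1 : iα = iβ
  · subst h1
    exact Or.inl ⟨(jα : ℤ) - jβ, fun c => by rw [hα c, hβ c]; ring⟩
  · by_cases h2 : iα = iγ
    · subst h2
      exact Or.inr ⟨(jα : ℤ) - jγ, fun c => by rw [hα c, hγ c]; ring⟩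
    · exfalso
      rw [if_neg h1, if_neg h2] at hαS
      simp at hαS

section TwoRelations

/-! ### The eight letters, the two relations, the four determinants (explicit hypotheses, shared by the four theorems below) -/

variable {u v : Fin m → MvPolynomial (Fin 2) ℂ} (hm : 2 ≤ m) {α₁ β₁ γ₁ δ₁ α₂ β₂ γ₂ δ₂ : Expo}
  (hα₁ : α₁ ∈ tailSupport u v) (hβ₁ : β₁ ∈ tailSupport u v) (hγ₁ : γ₁ ∈ tailSupport u v) (hδ₁ : δ₁ ∈ tailSupport u v)
  (hα₂ : α₂ ∈ tailSupport u v) (hβ₂ : β₂ ∈ tailSupport u v) (hγ₂ : γ₂ ∈ tailSupport u v) (hδ₂ : δ₂ ∈ tailSupport u v)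
  (hrel₁ : α₁ + δ₁ = β₁ + γ₁) (hrel₂ : α₂ + δ₂ = β₂ + γ₂)
  (hββ : (((α₁ 0 : ℕ) : ℤ) - β₁ 0) * (((α₂ 1 : ℕ) : ℤ) - β₂ 1) ≠ (((α₁ 1 : ℕ) : ℤ) - β₁ 1) * (((α₂ 0 : ℕ) : ℤ) - β₂ 0))
  (hβγ : (((α₁ 0 : ℕ) : ℤ) - β₁ 0) * (((α₂ 1 : ℕ) : ℤ) - γ₂ 1) ≠ (((α₁ 1 : ℕ) : ℤ) - β₁ 1) * (((α₂ 0 : ℕ) : ℤ) - γ₂ 0))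
  (hγβ : (((α₁ 0 : ℕ) : ℤ) - γ₁ 0) * (((α₂ 1 : ℕ) : ℤ) - β₂ 1) ≠ (((α₁ 1 : ℕ) : ℤ) - γ₁ 1) * (((α₂ 0 : ℕ) : ℤ) - β₂ 0))
  (hγγ : (((α₁ 0 : ℕ) : ℤ) - γ₁ 0) * (((α₂ 1 : ℕ) : ℤ) - γ₂ 1) ≠ (((α₁ 1 : ℕ) : ℤ) - γ₁ 1) * (((α₂ 0 : ℕ) : ℤ) - γ₂ 0))
include hm hα₁ hβ₁ hγ₁ hδ₁ hα₂ hβ₂ hγ₂ hδ₂ hrel₁ hrel₂ hββ hβγ hγβ hγγ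

/-- **Literal form**: two exchange relations in independent directions ⇒ NO tower presentation of the tail alphabet is realizable-dissociated. [folklore] -/
theorem towerAlphabet_not_dissociatedE_of_twoDirections :
    ∀ (n : ℕ) (x : Fin n → Expo) (d : Fin 2 → ℤ) (E : Finset ℕ), TowerAlphabet u v x d E → ¬ TowerDissociatedE x d m E := by
  intro n x d E hA hdis
  have h1 := sub_parallel_of_exchange hm x d E (hA _ hα₁) (hA _ hβ₁) (hA _ hγ₁) (hA _ hδ₁) hrel₁ hdis
  have h2 := sub_parallel_of_exchange hm x d E (hA _ hα₂) (hA _ hβ₂) (hA _ hγ₂) (hA _ hδ₂) hrel₂ hdis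
  rcases h1 with ⟨t₁, ht₁⟩ | ⟨t₁, ht₁⟩ <;> rcases h2 with ⟨t₂, ht₂⟩ | ⟨t₂, ht₂⟩
  · exact hββ (by rw [ht₁ 0, ht₁ 1, ht₂ 0, ht₂ 1]; ring)
  · exact hβγ (by rw [ht₁ 0, ht₁ 1, ht₂ 0, ht₂ 1]; ring)
  · exact hγβ (by rw [ht₁ 0, ht₁ 1, ht₂ 0, ht₂ 1]; ring)
  · exact hγγ (by rw [ht₁ 0, ht₁ 1, ht₂ 0, ht₂ 1]; ring)

/-- **The v25 hatch (R13♯) existential of `ResidualLawV25`, negated verbatim.** [folklore] -/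
theorem towerHatch_false_of_twoDirections :
    ¬ ∃ (n : ℕ) (x : Fin n → Expo) (d : Fin 2 → ℤ) (E : Finset ℕ), TowerAlphabet u v x d E ∧ TowerDissociatedE x d m E :=
  fun ⟨n, x, d, E, hA, hdis⟩ =>
    towerAlphabet_not_dissociatedE_of_twoDirections hm hα₁ hβ₁ hγ₁ hδ₁ hα₂ hβ₂ hγ₂ hδ₂ hrel₁ hrel₂ hββ hβγ hγβ hγγ n x d E hA hdis

/-- **Literal form, R12 twin**: no presentation inside `X ⊔ (X+d)` is carrier-dissociated (via ✓ `towerClause_of_shiftedClause`,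
`towerAlphabet_range_of_le`, `towerDissociated_one_iff`, `towerDissociatedE_of_towerDissociated` at `E = range 2`). [folklore] -/
theorem shiftedAlphabet_not_carrierDissociated_of_twoDirections :
    ∀ (n : ℕ) (x : Fin n → Expo) (d : Fin 2 → ℤ),
      (∀ e ∈ tailSupport u v, ∃ i, e = x i ∨ ∀ c, ((e c : ℕ) : ℤ) = shiftZ x d i c) → ¬ CarrierDissociated x d m := by
  intro n x d hA hdis
  have hE : ∀ j ∈ Finset.range (1 + 1), j ≤ 1 := fun j hj => by
    have := Finset.mem_range.mp hj
    omega
  exact towerAlphabet_not_dissociatedE_of_twoDirections hm hα₁ hβ₁ hγ₁ hδ₁ hα₂ hβ₂ hγ₂ hδ₂ hrel₁ hrel₂ hββ hβγ hγβ hγγ n x d _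
    (towerAlphabet_range_of_le (towerClause_of_shiftedClause hA))
    (towerDissociatedE_of_towerDissociated hE ((towerDissociated_one_iff x d m).mpr hdis))

/-- **The v24 hatch (R12) existential of `ResidualLawV25`, negated verbatim.** [folklore] -/
theorem shiftedHatch_false_of_twoDirections :
    ¬ ∃ (n : ℕ) (x : Fin n → Expo) (d : Fin 2 → ℤ),
        (∀ e ∈ tailSupport u v, ∃ i, e = x i ∨ ∀ c, ((e c : ℕ) : ℤ) = shiftZ x d i c) ∧ CarrierDissociated x d m :=
  fun ⟨n, x, d, hA, hdis⟩ =>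
    shiftedAlphabet_not_carrierDissociated_of_twoDirections hm hα₁ hβ₁ hγ₁ hδ₁ hα₂ hβ₂ hγ₂ hδ₂ hrel₁ hrel₂ hββ hβγ hγβ hγγ n x d hA hdis

end TwoRelations

end Summit.ValiantsHypothesis.ValiantsHypothesis.Theorems.NewtonUnitEquations.TwoProducts.Negative.TwoDirections
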